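import Mathlib
import Literature.Probability.Percolation.DiagonalStripQKZUniqueness
import HarnessLib

/-!
# Degree transfer from any polynomial solution of the boundary qKZ system to the ground state

Topic `Literature/Probability/Percolation`. Ikhlef–Ponsaing (J. Stat. Phys. 149 (2012),
arXiv:1202.5476) §3.4–§3.5 normalise the ground state of the diagonal-strip transfer matrix so that
its components are (Laurent) polynomials without common factor and then USE the explicit minimal
polynomial solution of the exact system (20)–(22) (de Gier–Pyatov's factorised solution, Thm. 1 and
Prop. 4 of Adv. Theor. Math. Phys. 14 (2010); Di Francesco–Zinn-Justin's integral solution;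
Hagendorf–Liénardy's vertex-model solution) as "the" ground state: its degree (`4m` in each `z_k`,
IP12 Prop. 3.4 "the degree of `Z_L`, which is set by solving the qKZ equation") is what makes the
interpolation arguments of Props. 3.4 and 4.5 work.

This file makes that identification a theorem. `IsPolyQKZSolution m q Φ e` packages a polynomial
solution `Φ` of the exact system (all bulk levels, both reflections with the monomial twist
`z^{2e}`) supported on the physical sector. By the uniqueness theorem
`qKZ_solution_eq_smul_groundState` (`DiagonalStripQKZUniqueness`) and primitivity of the ground
state `P`:

* `IsPolyQKZSolution.exists_eq_C_mul`: `Φ = C₀ • P` with a POLYNOMIAL scalar `C₀`;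
* `IsPolyQKZSolution.fixed`: every such `Φ` is `t(w; z⃗)`-fixed (IP12 (19));
* `IsPolyQKZSolution.degreeOf_groundState_le`, `IsPolyQKZSolution.degreeOf_sum_groundState_le`:
  along any injective ring endomorphism `θ` of `ℂ[X]` (identity: per-variable degrees; the
  substitution `X_i ↦ X_i X_N, X_j ↦ X_j X_N`: joint degrees) the degrees of the components of `P`
  and of the sum `Z = Σ_Q P_Q` are bounded by those of `Φ ≠ 0`.

So the degree bounds of IP12 §3.5 for the ground state follow from the EXISTENCE of one nonzero
polynomial solution with those bounds, which is the published theorem cited below; no minimality or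
uniqueness statement about that solution is needed.

## References

* Y. Ikhlef, A. K. Ponsaing, *Finite-size left-passage probability in percolation*, J. Stat. Phys.
  149 (2012) 10–36, arXiv:1202.5476, §3.4 (19)–(22), §3.5, proof of Prop. 3.4. [IkhlefPonsaing2012]
* J. de Gier, P. Pyatov, *Factorised solutions of Temperley–Lieb qKZ equations on a segment*, Adv.
  Theor. Math. Phys. 14 (2010) 795–877, arXiv:0710.5362, Thm. 1, Props. 3–4, Cor. 1. [deGierPyatov2010]
* C. Hagendorf, J. Liénardy, *The open XXZ chain at Δ = −1/2 and the boundary quantum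
  Knizhnik–Zamolodchikov equations*, J. Stat. Mech. (2021) 013104, arXiv:2008.03220, §3.
  [HagendorfLienardy2021]
-/

namespace Literature.Probability.Percolation

open Finset Literature.Probability.LatticeModels Literature.Probability.LatticeModels.TemperleyLieb

section DegreeTransfer

open MvPolynomial

variable {m : ℕ}

/-- The symmetric monomial `z_1 z_2 ⋯ z_{2m+1}`. [folklore] -/
noncomputable def genZprod (m : ℕ) : RapidityField ℂ := ∏ k ∈ Finset.range (2 * m + 1), genZ ℂ (k + 1)

/-- `z_1 ⋯ z_L ≠ 0`. [folklore] -/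
theorem genZprod_ne_zero : genZprod m ≠ 0 :=
  Finset.prod_ne_zero_iff.2 fun k _ => genZ_ne_zero (k + 1)

/-- The symmetric monomial is invariant under the bulk swaps. [folklore] -/
theorem genSwap_genZprod {i : ℕ} (hi1 : 1 ≤ i) (hi2 : i ≤ 2 * m) : genSwap ℂ i (genZprod m) = genZprod m := by
  rw [genZprod, map_prod]
  simp_rw [genSwap_genZ_eq]
  refine Finset.prod_equiv (Equiv.swap (i - 1) i) (fun k => ?_) (fun k hk => ?_)
  · simp only [Finset.mem_range]
    rw [Equiv.swap_apply_def]
    split_ifs <;> omega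
  · rw [Equiv.swap_apply_def]
    by_cases h1 : k + 1 = i
    · rw [if_pos h1, if_pos (by omega)]
    · rw [if_neg h1]
      by_cases h2 : k + 1 = i + 1
      · rw [if_pos h2, if_neg (by omega), if_pos (by omega)]; congr 1; omega
      · rw [if_neg h2, if_neg (by omega), if_neg (by omega)]

/-- The top inversion divides the symmetric monomial by `z_L²`. [folklore] -/
theorem genInv_top_genZprod : genInv ℂ (2 * m + 1) (genZprod m) = genZprod m * ((genZ ℂ (2 * m + 1))⁻¹) ^ 2 := by
  have h1 : ∀ k ∈ Finset.range (2 * m), genInv ℂ (2 * m + 1) (genZ ℂ (k + 1)) = genZ ℂ (k + 1) := fun k hk => by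
    rw [genInv_genZ_eq, if_neg (by have := Finset.mem_range.1 hk; omega)]
  rw [genZprod, Finset.prod_range_succ, map_mul, map_prod, Finset.prod_congr rfl h1, genInv_genZ_eq, if_pos rfl,
    mul_assoc]
  congr 1
  rw [sq, ← mul_assoc, mul_inv_cancel₀ (genZ_ne_zero _), one_mul]

/-- The bottom inversion divides the symmetric monomial by `z_1²`. [folklore] -/
theorem genInv_bot_genZprod : genInv ℂ 1 (genZprod m) = genZprod m * ((genZ ℂ 1)⁻¹) ^ 2 := by
  have h1 : ∀ k ∈ Finset.range (2 * m), genInv ℂ 1 (genZ ℂ (k + 1 + 1)) = genZ ℂ (k + 1 + 1) := fun k _ => by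
    rw [genInv_genZ_eq, if_neg (by omega)]
  rw [genZprod, Finset.prod_range_succ', map_mul, map_prod, Finset.prod_congr rfl h1, genInv_genZ_eq, if_pos rfl,
    mul_assoc]
  congr 1
  rw [sq, ← mul_assoc, mul_inv_cancel₀ (genZ_ne_zero _), one_mul]

/-- Exact exchange relations are homogeneous under `σ_i`-invariant scalars. [folklore] -/
theorem IsExactExchange.mul_invariant {q : ℂ} {i : ℕ} {g : ColPattern m → ColPattern m}
    {ψ : ColPattern m → RapidityField ℂ} (hex : IsExactExchange q i g ψ) {c : RapidityField ℂ}
    (hc : genSwap ℂ i c = c) : IsExactExchange q i g (fun Q => c * ψ Q) := by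
  intro Q
  have hpush : ipPush g (fun Q => c * ψ Q) Q = c * ipPush g ψ Q := by
    simp only [ipPush, Finset.mul_sum]
  rw [hpush, map_mul, hc]
  have h := hex Q
  linear_combination c * h

/-- **A polynomial solution of IP12's exact system (20)–(22)** on the physical sector, with monomial
twist `z^{2e}` at both reflections (for a polynomial vector palindromic of formal degree `d` in `z_1`
and `z_L` one has `e = -d/2`… any integer is allowed here). This is the shape in which an explicit
solution — de Gier–Pyatov's factorised solution, Di Francesco–Zinn-Justin's integral solution — enters.
[cite: IkhlefPonsaing2012, §3.4 (20)–(22); deGierPyatov2010, Thm. 1 and Prop. 4] -/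
structure IsPolyQKZSolution (m : ℕ) (q : ℂ) (Φ : ColPattern m → MvPolynomial ℕ ℂ) (e : ℤ) : Prop where
  supp : ∀ Q, Φ Q ≠ 0 → IsValid 0 Q ∧ IsPlanar Q ∧ lump Q = Q
  odd : ∀ j' : Fin m, IsExactExchange q (2 * (j' : ℕ) + 1) (cpJoin (Fin.castSucc j') j'.succ) (fun Q => toRF ℂ (Φ Q))
  even : ∀ b0 : Fin m, IsExactExchange q (2 * (b0 : ℕ) + 2) (cpIsolate b0.succ) (fun Q => toRF ℂ (Φ Q))
  top : ∀ Q, genInv ℂ (2 * m + 1) (toRF ℂ (Φ Q)) = genZ ℂ (2 * m + 1) ^ (2 * e) * toRF ℂ (Φ Q)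
  bot : ∀ Q, genInv ℂ 1 (toRF ℂ (Φ Q)) = genZ ℂ 1 ^ (2 * e) * toRF ℂ (Φ Q)

/-- **Every polynomial solution of (20)–(22) is a POLYNOMIAL multiple of the primitive ground state**
(`P, a` as in `exists_groundState_exact_sameTwist`): `Φ = C₀ · P` with `C₀ ∈ ℂ[X]`. Rescale `Φ` by the
symmetric monomial `(z_1 ⋯ z_L)^{e-a}` to match the twists, apply uniqueness over the rapidity field,
and clear the scalar with primitivity. [cite: IkhlefPonsaing2012, §3.4 (20)–(22)] -/
theorem IsPolyQKZSolution.exists_eq_C_mul {q : ℂ} (hq : q ^ 2 + q + 1 = 0) {P : ColPattern m → MvPolynomial ℕ ℂ}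
    {a : ℤ} (hprim : PolyPrimitive P)
    (hP : ∀ Q', ∑ Q, ipTransferMatrixW m (genC ℂ q) (genW ℂ) (genZ ℂ) Q Q' * toRF ℂ (P Q) = toRF ℂ (P Q'))
    (hodd : ∀ j' : Fin m, IsExactExchange q (2 * (j' : ℕ) + 1) (cpJoin (Fin.castSucc j') j'.succ) (fun Q => toRF ℂ (P Q)))
    (heven : ∀ b0 : Fin m, IsExactExchange q (2 * (b0 : ℕ) + 2) (cpIsolate b0.succ) (fun Q => toRF ℂ (P Q)))
    (htop : ∀ Q, genInv ℂ (2 * m + 1) (toRF ℂ (P Q)) = genZ ℂ (2 * m + 1) ^ (2 * a) * toRF ℂ (P Q))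
    (hbot : ∀ Q, genInv ℂ 1 (toRF ℂ (P Q)) = genZ ℂ 1 ^ (2 * a) * toRF ℂ (P Q))
    {Φ : ColPattern m → MvPolynomial ℕ ℂ} {e : ℤ} (hΦ : IsPolyQKZSolution m q Φ e) :
    ∃ C₀ : MvPolynomial ℕ ℂ, ∀ Q, Φ Q = C₀ * P Q := by
  set M : RapidityField ℂ := genZprod m ^ (e - a) with hM
  have hM0 : M ≠ 0 := zpow_ne_zero _ genZprod_ne_zero
  set ψ' : ColPattern m → RapidityField ℂ := fun Q => M * toRF ℂ (Φ Q) with hψ'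
  have hsupp' : ∀ Q, ψ' Q ≠ 0 → IsValid 0 Q ∧ IsPlanar Q ∧ lump Q = Q := fun Q h =>
    hΦ.supp Q fun h0 => h (by simp only [hψ', h0, map_zero, mul_zero])
  have hMσ : ∀ i, 1 ≤ i → i ≤ 2 * m → genSwap ℂ i M = M := fun i hi1 hi2 => by
    rw [hM, map_zpow₀, genSwap_genZprod hi1 hi2]
  have hodd' : ∀ j' : Fin m, IsExactExchange q (2 * (j' : ℕ) + 1) (cpJoin (Fin.castSucc j') j'.succ) ψ' :=
    fun j' => (hΦ.odd j').mul_invariant (hMσ _ (by omega) (by omega))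
  have heven' : ∀ b0 : Fin m, IsExactExchange q (2 * (b0 : ℕ) + 2) (cpIsolate b0.succ) ψ' :=
    fun b0 => (hΦ.even b0).mul_invariant (hMσ _ (by omega) (by omega))
  have htop' : ∀ Q, genInv ℂ (2 * m + 1) (ψ' Q) = genZ ℂ (2 * m + 1) ^ (2 * a) * ψ' Q := by
    intro Q
    simp only [hψ']
    rw [map_mul, hΦ.top Q, hM, map_zpow₀, genInv_top_genZprod, mul_zpow, ← zpow_natCast, ← zpow_mul, inv_zpow']
    have hz := genZ_ne_zero (K₀ := ℂ) (2 * m + 1)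
    rw [show genZprod m ^ (e - a) * genZ ℂ (2 * m + 1) ^ (-(((2 : ℕ) : ℤ) * (e - a))) * (genZ ℂ (2 * m + 1) ^ (2 * e) * toRF ℂ (Φ Q)) =
      (genZ ℂ (2 * m + 1) ^ (-(((2 : ℕ) : ℤ) * (e - a))) * genZ ℂ (2 * m + 1) ^ (2 * e)) * (genZprod m ^ (e - a) * toRF ℂ (Φ Q)) by ring,
      ← zpow_add₀ hz]
    congr 2; push_cast; ring
  have hbot' : ∀ Q, genInv ℂ 1 (ψ' Q) = genZ ℂ 1 ^ (2 * a) * ψ' Q := by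
    intro Q
    simp only [hψ']
    rw [map_mul, hΦ.bot Q, hM, map_zpow₀, genInv_bot_genZprod, mul_zpow, ← zpow_natCast, ← zpow_mul, inv_zpow']
    have hz := genZ_ne_zero (K₀ := ℂ) 1
    rw [show genZprod m ^ (e - a) * genZ ℂ 1 ^ (-(((2 : ℕ) : ℤ) * (e - a))) * (genZ ℂ 1 ^ (2 * e) * toRF ℂ (Φ Q)) =
      (genZ ℂ 1 ^ (-(((2 : ℕ) : ℤ) * (e - a))) * genZ ℂ 1 ^ (2 * e)) * (genZprod m ^ (e - a) * toRF ℂ (Φ Q)) by ring,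
      ← zpow_add₀ hz]
    congr 2; push_cast; ring
  obtain ⟨c, hc⟩ := qKZ_solution_eq_smul_groundState hq hprim hP hodd heven htop hbot hsupp' hodd' heven' hbot' htop'
  -- `toRF (Φ Q) = (c / M) * toRF (P Q)` with `c / M` integral by primitivity
  have hc' : ∀ Q, c * M⁻¹ * toRF ℂ (P Q) = toRF ℂ (Φ Q) := by
    intro Q
    have h1 : M * toRF ℂ (Φ Q) = c * toRF ℂ (P Q) := hc Q
    calc c * M⁻¹ * toRF ℂ (P Q) = M⁻¹ * (c * toRF ℂ (P Q)) := by ring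
      _ = M⁻¹ * (M * toRF ℂ (Φ Q)) := by rw [h1]
      _ = toRF ℂ (Φ Q) := by rw [← mul_assoc, inv_mul_cancel₀ hM0, one_mul]
  obtain ⟨C₀, hC₀⟩ := hprim.exists_eq_toRF (c := c * M⁻¹) fun Q => ⟨Φ Q, hc' Q⟩
  refine ⟨C₀, fun Q => toRF_injective ?_⟩
  rw [map_mul, ← hC₀, hc' Q]

/-- **(UNZIP) Every polynomial solution of (20)–(22) is `t(w; z⃗)`-fixed.**
[cite: IkhlefPonsaing2012, §3.4] -/
theorem IsPolyQKZSolution.fixed {q : ℂ} (hq : q ^ 2 + q + 1 = 0) {Φ : ColPattern m → MvPolynomial ℕ ℂ} {e : ℤ}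
    (hΦ : IsPolyQKZSolution m q Φ e) (Q' : ColPattern m) :
    ∑ Q, ipTransferMatrixW m (genC ℂ q) (genW ℂ) (genZ ℂ) Q Q' * toRF ℂ (Φ Q) = toRF ℂ (Φ Q') := by
  obtain ⟨P, a, hprim, hP, hodd, heven, htop, hbot, -⟩ := exists_groundState_exact_sameTwist (m := m) hq
  obtain ⟨C₀, hC₀⟩ := hΦ.exists_eq_C_mul hq hprim hP hodd heven htop hbot
  simp_rw [hC₀, map_mul]
  rw [← hP Q', Finset.mul_sum]
  exact Finset.sum_congr rfl fun Q _ => by ring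

/-- **Degree transfer (per variable)**: with `P` the primitive ground state and `Φ ≠ 0` any polynomial
solution of (20)–(22), `deg_{X_k} P_Q ≤ deg_{X_k} Φ_Q` for every pattern `Q` and variable `k`.
[cite: IkhlefPonsaing2012, §3.4–§3.5] -/
theorem IsPolyQKZSolution.degreeOf_groundState_le {q : ℂ} (hq : q ^ 2 + q + 1 = 0)
    {P : ColPattern m → MvPolynomial ℕ ℂ} {a : ℤ} (hprim : PolyPrimitive P)
    (hP : ∀ Q', ∑ Q, ipTransferMatrixW m (genC ℂ q) (genW ℂ) (genZ ℂ) Q Q' * toRF ℂ (P Q) = toRF ℂ (P Q'))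
    (hodd : ∀ j' : Fin m, IsExactExchange q (2 * (j' : ℕ) + 1) (cpJoin (Fin.castSucc j') j'.succ) (fun Q => toRF ℂ (P Q)))
    (heven : ∀ b0 : Fin m, IsExactExchange q (2 * (b0 : ℕ) + 2) (cpIsolate b0.succ) (fun Q => toRF ℂ (P Q)))
    (htop : ∀ Q, genInv ℂ (2 * m + 1) (toRF ℂ (P Q)) = genZ ℂ (2 * m + 1) ^ (2 * a) * toRF ℂ (P Q))
    (hbot : ∀ Q, genInv ℂ 1 (toRF ℂ (P Q)) = genZ ℂ 1 ^ (2 * a) * toRF ℂ (P Q))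
    {Φ : ColPattern m → MvPolynomial ℕ ℂ} {e : ℤ} (hΦ : IsPolyQKZSolution m q Φ e) (hΦ0 : Φ ≠ 0)
    (θ : MvPolynomial ℕ ℂ →+* MvPolynomial ℕ ℂ) (hθ : ∀ p, θ p = 0 → p = 0) (k : ℕ) (Q : ColPattern m) :
    (θ (P Q)).degreeOf k ≤ (θ (Φ Q)).degreeOf k := by
  obtain ⟨C₀, hC₀⟩ := hΦ.exists_eq_C_mul hq hprim hP hodd heven htop hbot
  have hC0 : C₀ ≠ 0 := by
    rintro rfl
    exact hΦ0 (funext fun Q => by rw [hC₀ Q, zero_mul]; rfl)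
  by_cases hPQ : P Q = 0
  · rw [hPQ, map_zero, degreeOf_zero]; exact Nat.zero_le _
  rw [hC₀ Q, map_mul, degreeOf_mul_eq (fun h => hC0 (hθ _ h)) (fun h => hPQ (hθ _ h))]
  exact Nat.le_add_left _ _

/-- **Degree transfer for the sums**: `Σ_Q Φ_Q = C₀ · Σ_Q P_Q`, so along any injective ring endomorphism
`θ` the `X_k`-degree of `θ(Σ P)` is at most that of `θ(Σ Φ)` (both sums are nonzero).
[cite: IkhlefPonsaing2012, Prop. 3.4 (proof)] -/
theorem IsPolyQKZSolution.degreeOf_sum_groundState_le {q : ℂ} (hq : q ^ 2 + q + 1 = 0)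
    {P : ColPattern m → MvPolynomial ℕ ℂ} {a : ℤ} (hprim : PolyPrimitive P)
    (hP : ∀ Q', ∑ Q, ipTransferMatrixW m (genC ℂ q) (genW ℂ) (genZ ℂ) Q Q' * toRF ℂ (P Q) = toRF ℂ (P Q'))
    (hodd : ∀ j' : Fin m, IsExactExchange q (2 * (j' : ℕ) + 1) (cpJoin (Fin.castSucc j') j'.succ) (fun Q => toRF ℂ (P Q)))
    (heven : ∀ b0 : Fin m, IsExactExchange q (2 * (b0 : ℕ) + 2) (cpIsolate b0.succ) (fun Q => toRF ℂ (P Q)))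
    (htop : ∀ Q, genInv ℂ (2 * m + 1) (toRF ℂ (P Q)) = genZ ℂ (2 * m + 1) ^ (2 * a) * toRF ℂ (P Q))
    (hbot : ∀ Q, genInv ℂ 1 (toRF ℂ (P Q)) = genZ ℂ 1 ^ (2 * a) * toRF ℂ (P Q))
    {Φ : ColPattern m → MvPolynomial ℕ ℂ} {e : ℤ} (hΦ : IsPolyQKZSolution m q Φ e) (hΦ0 : Φ ≠ 0)
    (θ : MvPolynomial ℕ ℂ →+* MvPolynomial ℕ ℂ) (hθ : ∀ p, θ p = 0 → p = 0) (k : ℕ) :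
    (θ (∑ Q, P Q)).degreeOf k ≤ (θ (∑ Q, Φ Q)).degreeOf k := by
  obtain ⟨C₀, hC₀⟩ := hΦ.exists_eq_C_mul hq hprim hP hodd heven htop hbot
  have hC0 : C₀ ≠ 0 := by
    rintro rfl
    exact hΦ0 (funext fun Q => by rw [hC₀ Q, zero_mul]; rfl)
  have hP0 : P ≠ 0 := by
    obtain ⟨Q₀, hQ₀⟩ := hprim.exists_ne_zero
    intro h; exact hQ₀ (congrFun h Q₀)
  have hsum : ∑ Q, Φ Q = C₀ * ∑ Q, P Q := by rw [Finset.mul_sum]; exact Finset.sum_congr rfl fun Q _ => hC₀ Q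
  rw [hsum, map_mul, degreeOf_mul_eq (fun h => hC0 (hθ _ h)) (fun h => groundState_sum_ne_zero hq hP0 hP (hθ _ h))]
  exact Nat.le_add_left _ _

end DegreeTransfer

end Literature.Probability.Percolation
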